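import Summits.ValiantsHypothesis.ValiantsHypothesis.Theorems.KPlusLogSqLawTropicalBEpochLaw

/-!
# Route «KPlusLogSqLaw», crux `TropicalB` (stmt-ValiantsHypothesis-19771) — INERT CLASSES: at integer slopes, every exponent value lying
# above a gap larger than `m·(smaller value) + 2m·max|v|` has a FROZEN column count along every dominant chain (one count at positive slopes,
# one at negative slopes); hence `n + 1 ≤ 2·(m+1)^j + 1`, `j` = the number of values below the inert range — for EVERY design

HONEST FRAMING.  Sequel of `…TropicalBEpochLaw` (this seat, p574666) toward the registered stubs of `Cruxes/TropicalB/Lines/birth.lean` (crux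
`Summit.ValiantsHypothesis.ValiantsHypothesis.Theses.KPlusLogSqLaw.TropicalB`, item stmt-ValiantsHypothesis-19771, route KPlusLogSqLaw, DRAFT; cell
`pub-symmetroid`, seat val-sym-trop-p1 g12, 2026-08-27; `--supports … --as helper`).  A STRUCTURE law valid for ALL dominance designs — it replaces
the sector hypothesis of the epoch law (all values pairwise separated by `ρ > 4mR`) by a LOCAL criterion per value — but it is empty when no value
satisfies the criterion (then `j` = all values and the bound is counting-like); it bounds nothing for `TropicalB` in its window and bears on neither
`WeakLifting`, the doors, `MatrixDescartes` (stmt-ValiantsHypothesis-18050) nor VP ≠ VNP.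

THE CRITERION.  `R ≥ max |v|`.  A value `D` of `d` is INERT if `2mR < D` and `m·D' + 2mR < D` for every smaller value `D'` of `d`; a threshold
`D₀` is INERT if every value `≥ D₀` is inert (`hinert` below, stated on classes).  Because the slopes of `TropRootLawAt` are integers (`|θ| ≥ 1` off
`θ = 0`), the freezing exchange of the epoch law needs no `θ`-dependent bookkeeping:
* `Inert.slope_gap` — class maps `x, y` with equally many columns of every value `> D`, `#{d = D}` larger for `y`, and every column of `x` below
  `D` of value `D'` with `m·D' + 2mR < D`: then `S x + 2mR < S y` (`S = Σᵢ d`);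
* `Inert.weight_gap` — with `|v| ≤ R`: `y` beats `x` at every slope `θ ≥ 1` and loses at every `θ ≤ −1`;
* `Inert.countVal_eq` — two unique optima at nonzero slopes of one sign agree on the count of every value `≥ D₀` (largest differing inert value);
* `Inert.card_sign_le` — the chain indices of one sign inject, by the vector of counts of the values `< D₀`, into `(values < D₀) → [0, m]`:
  at most `(m+1)^j` of them, `j = #{values of d below D₀}`;
* `Inert.chain_le` — **THE INERT-CLASSES LAW**: every chain of unique optima at strictly increasing integer slopes with distinct consecutive terms
  has `n + 1 ≤ 2·(m+1)^j + 1`.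
READING (located).  (i) At integer slopes the classes above the last «small» gap never move: to use `K` classes a design needs EVERY consecutive
gap of its exponent values to satisfy `D_i ≤ m·D_{i−1} + 2m·max|v|` — exponents at most geometric of ratio `m` up to the additive slack
`2m·max|v|` (SHIFT-THREE: top exponent `≈ 2m²` against `m + 2m·Θ(m⁴)` ✓); together with `NewtonPolygon.chain_le_valSpread` (`n ≤ 4mR + 1`) this is
the second way bounded valuations tie the exponents.  (ii) The `K`-free epoch law (`Epoch.chain_le_sharp`, `2m + 5`) is the case «every value above
the least positive one is inert» (`j ≤ 2` here gives `2(m+1)² + 1`; the sharp count uses that the value `0` contributes nothing to the slope).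
[folklore: exchange bookkeeping; this file]
-/

set_option linter.dupNamespace false
set_option autoImplicit false

namespace Summit.ValiantsHypothesis.ValiantsHypothesis.Theorems.KPlusLogSqLaw

namespace Inert

open Summit.ValiantsHypothesis.ValiantsHypothesis.Theorems.MatrixDescartes.Negative
open Summit.ValiantsHypothesis.ValiantsHypothesis.Theorems.LacunarySymmetroidMatrixDescartes.TropicalCensus
open Finset
open scoped BigOperators

variable {m K : ℕ}

/-! ## 1. The freezing exchange with a local gap -/

/-- **Slope gap (local).**  If `x, y : Fin m → Fin K` have equally many columns of every value `> D`, `y` has more columns of value `D`,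
`2mR < D`, and every column of `x` of value `D' < D` has `m·D' + 2mR < D`, then `Σᵢ d (x i) + 2mR < Σᵢ d (y i)`. [this file] -/
theorem slope_gap (d : Fin K → ℕ) (R : ℕ) (x y : Fin m → Fin K) (D : ℕ) (hD : 2 * m * R < D)
    (hbelow : ∀ i, d (x i) < D → m * d (x i) + 2 * m * R < D)
    (habove : ∀ D' : ℕ, D < D' → (univ.filter fun i => d (x i) = D').card = (univ.filter fun i => d (y i) = D').card)
    (hcnt : (univ.filter fun i => d (x i) = D).card < (univ.filter fun i => d (y i) = D).card) :
    ∑ i, d (x i) + 2 * m * R < ∑ i, d (y i) := by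
  obtain ⟨i₀, _⟩ : ∃ i, d (y i) = D := by
    have hpos : 0 < (univ.filter fun i => d (y i) = D).card := by omega
    obtain ⟨i, hi⟩ := card_pos.mp hpos
    exact ⟨i, (mem_filter.mp hi).2⟩
  have hm : 0 < m := Fin.pos i₀
  -- the part of `x` below `D`: `m·below + #below·(2mR) < #below·D`, and `#below ≤ m`, so `below + 2mR + 1 ≤ D`
  set B := univ.filter (fun i => d (x i) < D) with hB
  have hBle : B.card ≤ m := (card_le_univ _).trans (by rw [Fintype.card_fin])
  have hsum : m * ∑ i ∈ B, d (x i) + B.card * (2 * m * R + 1) ≤ B.card * D := by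
    rw [mul_sum, card_eq_sum_ones, sum_mul, sum_mul, ← sum_add_distrib]
    refine sum_le_sum fun i hi => ?_
    have := hbelow i (mem_filter.mp hi).2
    simp only [one_mul]
    omega
  have hbelow' : ∑ i ∈ B, d (x i) + 2 * m * R + 1 ≤ D := by
    rcases Nat.eq_zero_or_pos B.card with h0 | hBpos
    · have : ∑ i ∈ B, d (x i) = 0 := by rw [card_eq_zero.mp h0, sum_empty]
      omega
    · -- from `m·Σ + #B·(2mR+1) ≤ #B·D ≤ m·D`… divide by `m` after bounding `#B ≤ m`
      have h1 : m * ∑ i ∈ B, d (x i) + m * (2 * m * R + 1) ≤ m * D := by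
        have h2 : B.card * D ≤ m * D := Nat.mul_le_mul_right _ hBle
        have h3 : m * (∑ i ∈ B, d (x i)) * B.card + B.card * (2 * m * R + 1) * B.card ≤ B.card * D * B.card :=
          by nlinarith
        nlinarith
      have h4 : m * (∑ i ∈ B, d (x i) + 2 * m * R + 1) ≤ m * D := by rw [mul_add, mul_add] at *; omega
      exact Nat.le_of_mul_le_mul_left h4 hm
  rw [sum_d_split3 d x D, sum_d_split3 d y D, sum_above_eq_of_countVal d x y D habove]
  have hDc : D * (univ.filter fun i => d (x i) = D).card + D ≤ D * (univ.filter fun i => d (y i) = D).card := by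
    rw [← Nat.mul_succ]; exact Nat.mul_le_mul_left D hcnt
  have : ∑ i ∈ univ.filter (fun i => d (x i) < D), d (x i) = ∑ i ∈ B, d (x i) := rfl
  omega

/-- **Weight gap (local).**  Under the hypotheses of `slope_gap` and `|v| ≤ R`: `y` beats `x` at every integer slope `θ > 0` and loses at every
`θ < 0` (`|θ| ≥ 1`, `|V y − V x| ≤ 2mR < |θ|·(S y − S x)`). [this file] -/
theorem weight_gap (d : Fin K → ℕ) (v : Fin m → Fin m → Fin K → ℤ) (R : ℕ) (hv : ∀ i j l, (v i j l).natAbs ≤ R)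
    {θ : ℤ} (x y : Equiv.Perm (Fin m) × (Fin m → Fin K)) (D : ℕ) (hD : 2 * m * R < D)
    (hbelow : ∀ i, d (x.2 i) < D → m * d (x.2 i) + 2 * m * R < D)
    (habove : ∀ D' : ℕ, D < D' → (univ.filter fun i => d (x.2 i) = D').card = (univ.filter fun i => d (y.2 i) = D').card)
    (hcnt : (univ.filter fun i => d (x.2 i) = D).card < (univ.filter fun i => d (y.2 i) = D).card) :
    (0 < θ → tropWeight d v θ x < tropWeight d v θ y) ∧ (θ < 0 → tropWeight d v θ y < tropWeight d v θ x) := by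
  have hgap := slope_gap d R x.2 y.2 D hD hbelow habove hcnt
  have hVx := (abs_le.mp (Epoch.abs_sum_v_le v R hv x))
  have hVy := (abs_le.mp (Epoch.abs_sum_v_le v R hv y))
  have hgapZ : (∑ i, (d (x.2 i) : ℤ)) + 2 * (m : ℤ) * R < ∑ i, (d (y.2 i) : ℤ) := by exact_mod_cast hgap
  unfold tropWeight
  constructor
  · intro hθ
    have h1 : (1 : ℤ) ≤ θ := hθ
    nlinarith
  · intro hθ
    have h1 : θ ≤ -1 := by omega
    nlinarith

/-! ## 2. Inert values have frozen counts -/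

/-- **AGREEMENT ON INERT VALUES.**  `R ≥ max |v|`; the threshold `D₀` is inert: every class `l` with `D₀ ≤ d l` has `2mR < d l` and
`m·d l' + 2mR < d l` for every class `l'` of smaller value.  Then two unique optima at nonzero slopes of one sign have the same number of columns of
every value `D ≥ D₀`. [this file] -/
theorem countVal_eq (d : Fin K → ℕ) (v ε : Fin m → Fin m → Fin K → ℤ) (R D₀ : ℕ) (hv : ∀ i j l, (v i j l).natAbs ≤ R)
    (hinert : ∀ l : Fin K, D₀ ≤ d l → 2 * m * R < d l ∧ ∀ l' : Fin K, d l' < d l → m * d l' + 2 * m * R < d l)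
    {θa θb : ℤ} (hsign : (0 < θa ∧ 0 < θb) ∨ (θa < 0 ∧ θb < 0))
    {p q : Equiv.Perm (Fin m) × (Fin m → Fin K)} (ha : IsDominant d v ε θa p) (hb : IsDominant d v ε θb q) :
    ∀ D : ℕ, D₀ ≤ D → (univ.filter fun i => d (p.2 i) = D).card = (univ.filter fun i => d (q.2 i) = D).card := by
  by_contra hcon
  push Not at hcon
  obtain ⟨D', hD'₀, hD'ne⟩ := hcon
  set T : Finset (Fin K) := univ.filter fun l =>
    D₀ ≤ d l ∧ (univ.filter fun i => d (p.2 i) = d l).card ≠ (univ.filter fun i => d (q.2 i) = d l).card with hT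
  have hTne : T.Nonempty := by
    obtain ⟨l, hl⟩ := Epoch.exists_class_of_countVal_ne d p.2 q.2 D' hD'ne
    exact ⟨l, mem_filter.mpr ⟨mem_univ _, by rw [hl]; exact ⟨hD'₀, hD'ne⟩⟩⟩
  obtain ⟨l₀, hl₀T, hl₀max⟩ := exists_max_image T d hTne
  obtain ⟨h₀, hne⟩ := (mem_filter.mp hl₀T).2
  set D := d l₀ with hD
  have habove : ∀ D'' : ℕ, D < D'' →
      (univ.filter fun i => d (p.2 i) = D'').card = (univ.filter fun i => d (q.2 i) = D'').card := by
    intro D'' hDD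
    by_contra hne'
    obtain ⟨l, hl⟩ := Epoch.exists_class_of_countVal_ne d p.2 q.2 D'' hne'
    have hlT : l ∈ T := mem_filter.mpr ⟨mem_univ _, by rw [hl]; exact ⟨h₀.trans hDD.le, hne'⟩⟩
    have := hl₀max l hlT
    rw [hl] at this
    exact absurd hDD (not_lt.mpr this)
  have hpq : p ≠ q := by rintro rfl; exact hne rfl
  obtain ⟨hDbig, hgapD⟩ := hinert l₀ h₀
  have hbelow_p : ∀ i, d (p.2 i) < D → m * d (p.2 i) + 2 * m * R < D := fun i hi => hgapD (p.2 i) hi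
  have hbelow_q : ∀ i, d (q.2 i) < D → m * d (q.2 i) + 2 * m * R < D := fun i hi => hgapD (q.2 i) hi
  rcases Nat.lt_or_gt_of_ne hne with hlt | hgt
  · rcases hsign with ⟨ha0, _⟩ | ⟨_, hb0⟩
    · have h := (weight_gap d v R hv p q D hDbig hbelow_p habove hlt).1 ha0
      exact absurd h (not_lt.mpr (ha.2 q hpq.symm hb.1).le)
    · have h := (weight_gap d v R hv p q D hDbig hbelow_p habove hlt).2 hb0
      exact absurd h (not_lt.mpr (hb.2 p hpq ha.1).le)
  · have habove' : ∀ D'' : ℕ, D < D'' →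
        (univ.filter fun i => d (q.2 i) = D'').card = (univ.filter fun i => d (p.2 i) = D'').card :=
      fun D'' h => (habove D'' h).symm
    rcases hsign with ⟨_, hb0⟩ | ⟨ha0, _⟩
    · have h := (weight_gap d v R hv q p D hDbig hbelow_q habove' hgt).1 hb0
      exact absurd h (not_lt.mpr (hb.2 p hpq ha.1).le)
    · have h := (weight_gap d v R hv q p D hDbig hbelow_q habove' hgt).2 ha0
      exact absurd h (not_lt.mpr (ha.2 q hpq.symm hb.1).le)

/-! ## 3. Counting: the indices of one sign are determined by the counts of the values below the threshold -/

/-- **Per-sign count.**  Along a dominant chain with distinct consecutive terms of ANY design with `|v| ≤ R` and an inert threshold `D₀`, the indices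
`k` with `0 < σ·θ_k` (`σ = ±1`) number at most `(m+1)^j`, `j = #{values of d below D₀}`: the vector of counts of those values determines the index
(the inert counts agree by `countVal_eq`, so equal vectors give equal slopes). [this file] -/
theorem card_sign_le (d : Fin K → ℕ) (v ε : Fin m → Fin m → Fin K → ℤ) (R D₀ : ℕ) (hv : ∀ i j l, (v i j l).natAbs ≤ R)
    (hinert : ∀ l : Fin K, D₀ ≤ d l → 2 * m * R < d l ∧ ∀ l' : Fin K, d l' < d l → m * d l' + 2 * m * R < d l)
    {n : ℕ} (θ : Fin (n + 1) → ℤ) (p : Fin (n + 1) → Equiv.Perm (Fin m) × (Fin m → Fin K))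
    (hθ : StrictMono θ) (hdom : ∀ k, IsDominant d v ε (θ k) (p k)) (hne : ∀ k : Fin n, p k.castSucc ≠ p k.succ)
    (σ : ℤ) (hσ : σ = 1 ∨ σ = -1) :
    (univ.filter fun k => 0 < σ * θ k).card ≤ (m + 1) ^ ((univ.image d).filter fun D => D < D₀).card := by
  classical
  have hsm : StrictMono fun k => ∑ i, d ((p k).2 i) := by
    refine Fin.strictMono_iff_lt_succ.mpr fun k => ?_
    exact sum_d_lt_of_dominant d v ε (hθ k.castSucc_lt_succ) (hne k) (hdom _) (hdom _)
  set I := univ.filter fun k => 0 < σ * θ k with hI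
  set B := (univ.image d).filter fun D => D < D₀ with hB
  have hsign : ∀ k ∈ I, ∀ k' ∈ I, (0 < θ k ∧ 0 < θ k') ∨ (θ k < 0 ∧ θ k' < 0) := by
    intro k hk k' hk'
    have h1 := (mem_filter.mp hk).2
    have h2 := (mem_filter.mp hk').2
    rcases hσ with rfl | rfl
    · left; constructor <;> linarith
    · right; constructor <;> linarith
  -- the count vector of the values below `D₀`
  let f : I → (B → Fin (m + 1)) := fun k D =>
    ⟨(univ.filter fun i => d ((p k.1).2 i) = D.1).card,
      Nat.lt_succ_of_le ((card_le_univ _).trans (by rw [Fintype.card_fin]))⟩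
  have hf : Function.Injective f := by
    rintro ⟨k, hk⟩ ⟨k', hk'⟩ hkk
    apply Subtype.ext
    apply hsm.injective
    show ∑ i, d ((p k).2 i) = ∑ i, d ((p k').2 i)
    refine sum_d_eq_of_countVal_eq d (p k).2 (p k').2 fun t => ?_
    by_cases ht : D₀ ≤ d t
    · exact countVal_eq d v ε R D₀ hv hinert (hsign k hk k' hk') (hdom k) (hdom k') (d t) ht
    · push Not at ht
      have hmem : d t ∈ B := mem_filter.mpr ⟨mem_image_of_mem d (mem_univ t), ht⟩
      have := congrArg (fun g => ((g ⟨d t, hmem⟩ : Fin (m + 1)) : ℕ)) hkk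
      simpa [f] using this
  have hcard := Fintype.card_le_of_injective f hf
  rwa [Fintype.card_coe, Fintype.card_fun, Fintype.card_coe, Fintype.card_fin] at hcard

/-- **THE INERT-CLASSES LAW.**  In EVERY dominance design of format `(m, K)` with valuations `|v| ≤ R`: if `D₀` is an inert threshold (every
value `D ≥ D₀` of `d` satisfies `2mR < D` and `m·D' + 2mR < D` for all smaller values `D'`), then every chain of unique optima at strictly increasing
integer slopes with distinct consecutive terms has `n + 1 ≤ 2·(m+1)^j + 1`, `j = #{values of d below D₀}` (the counts of the values `≥ D₀` take one
value on the positive slopes and one on the negative slopes). [this file] -/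
theorem chain_le (d : Fin K → ℕ) (v ε : Fin m → Fin m → Fin K → ℤ) (R D₀ : ℕ) (hv : ∀ i j l, (v i j l).natAbs ≤ R)
    (hinert : ∀ l : Fin K, D₀ ≤ d l → 2 * m * R < d l ∧ ∀ l' : Fin K, d l' < d l → m * d l' + 2 * m * R < d l)
    {n : ℕ} (θ : Fin (n + 1) → ℤ) (p : Fin (n + 1) → Equiv.Perm (Fin m) × (Fin m → Fin K))
    (hθ : StrictMono θ) (hdom : ∀ k, IsDominant d v ε (θ k) (p k)) (hne : ∀ k : Fin n, p k.castSucc ≠ p k.succ) :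
    n + 1 ≤ 2 * (m + 1) ^ ((univ.image d).filter fun D => D < D₀).card + 1 := by
  classical
  set J := (m + 1) ^ ((univ.image d).filter fun D => D < D₀).card with hJ
  have hpos := card_sign_le d v ε R D₀ hv hinert θ p hθ hdom hne 1 (Or.inl rfl)
  have hneg := card_sign_le d v ε R D₀ hv hinert θ p hθ hdom hne (-1) (Or.inr rfl)
  have hzero : (univ.filter fun k => θ k = 0).card ≤ 1 := by
    refine card_le_one.mpr fun a ha b hb => hθ.injective ?_
    rw [(mem_filter.mp ha).2, (mem_filter.mp hb).2]
  have hcover : (univ : Finset (Fin (n + 1))) ⊆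
      ((univ.filter fun k => 0 < (1 : ℤ) * θ k) ∪ (univ.filter fun k => 0 < (-1 : ℤ) * θ k)) ∪
        (univ.filter fun k => θ k = 0) := by
    intro k _
    rcases lt_trichotomy (θ k) 0 with h | h | h
    · exact mem_union_left _ (mem_union_right _ (mem_filter.mpr ⟨mem_univ _, by linarith⟩))
    · exact mem_union_right _ (mem_filter.mpr ⟨mem_univ _, h⟩)
    · exact mem_union_left _ (mem_union_left _ (mem_filter.mpr ⟨mem_univ _, by linarith⟩))
  calc n + 1 = (univ : Finset (Fin (n + 1))).card := by rw [card_univ, Fintype.card_fin]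
    _ ≤ (((univ.filter fun k => 0 < (1 : ℤ) * θ k) ∪ (univ.filter fun k => 0 < (-1 : ℤ) * θ k)) ∪
          (univ.filter fun k => θ k = 0)).card := card_le_card hcover
    _ ≤ ((univ.filter fun k => 0 < (1 : ℤ) * θ k).card + (univ.filter fun k => 0 < (-1 : ℤ) * θ k).card) +
          (univ.filter fun k => θ k = 0).card :=
        (card_union_le _ _).trans (Nat.add_le_add_right (card_union_le _ _) _)
    _ ≤ (J + J) + 1 := Nat.add_le_add (Nat.add_le_add hpos hneg) hzero
    _ = 2 * J + 1 := by ring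

end Inert

end Summit.ValiantsHypothesis.ValiantsHypothesis.Theorems.KPlusLogSqLaw
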